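import Literature.Algebra.Polynomial.UmbralConnectionConstants
import Mathlib.Tactic
import HarnessLib

/-!
# Erdélyi's duplication formula for the Laguerre polynomials (Rota–Kahaner–Odlyzko §11)

G.-C. Rota, D. Kahaner, A. Odlyzko, *Finite operator calculus* (1973), §11, pp. 730–731:

> The so-called "duplication formulas" for Laguerre polynomials (see, e.g. Rainville) are trivial
> consequences of Theorem 7; we shall only derive one of them to indicate the method. We are to
> express `L_n (ax)` as a linear combination of `L_k (x)`. By Section 7, the sequence `L_n (ax)` is
> basic to the operator `a⁻¹ D/(a⁻¹ D − I)`. We are, therefore, to find a formal power series `f (t)`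
> such that `a⁻¹ t/(a⁻¹ t − 1) = f (t/(t − 1))`. An easy computation gives `f (t) = t/[(1 − a) t + a]`.
> Now, the basic polynomials for `f (D)` are computed by Theorem 4; they are [`p_n (x)`, and `f (K)`,
> `K = D/(D − I)`, is the operator] whose basic sequence is, as we have remarked, `L_n (ax)`. Thus, we
> are led to Erdélyi's formula
> `L_n (ax) = Σ_{k≥1} (n!/k!) C(n−1, k−1) (1 − a)^{n−k} aᵏ L_k (x)`.

This file follows that derivation literally, for the basic Laguerre polynomials `L_n = laguerreBasic K n`
of the tree (`L_n (x) = Σ_k (n!/k!) C(n−1,k−1) (−x)ᵏ`, basic for `K (D)`, `K (t) = t/(t − 1)`;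
`LaguerreBasicSequence`, `UmbralInversePairs`), `a ≠ 0` in a field of characteristic `0`:
* the series computation `f (K (t)) = K (a⁻¹ t)` for `f (t) = t/((1 − a) t + a)`
  (`X_mul_inv_subst_laguerreSeries`);
* "the basic polynomials for `f (D)` are computed by Theorem 4":
  `p_n (x) = x ((1 − a) D + a)ⁿ x^{n−1} = Σ_j C(n,j) a^{n−j} (1 − a)ʲ (n−1)_j x^{n−j}`
  (`basicSequence_X_mul_C_add_inv`, from the tree's transfer formula
  `IsDeltaOperator.basicSequence_eq_X_mul_diffOp`);
* Theorem 7 (tree: `IsBasicSequence.umbralComp_diffOp_subst`) and §7 Proposition 4 (tree: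
  `IsBasicSequence.comp_C_mul_X`: `L_n (ax)` is basic for `K (a⁻¹ t)(D)`), with the uniqueness of basic
  sequences, give `L_n (ax) = p_n (L (x))`, i.e. **Erdélyi's formula** — in the transfer-formula indexing
  `L_n (ax) = Σ_j C(n,j) a^{n−j} (1 − a)ʲ (n−1)_j L_{n−j} (x)` (`laguerreBasic_comp_C_mul_X`) and exactly as
  printed, `L_n (ax) = Σ_{k=1}^{n} (n!/k!) C(n−1,k−1) aᵏ (1 − a)^{n−k} L_k (x)` (`laguerreBasic_comp_C_mul_X_eq_sum`).

## References
* [RotaKahanerOdlyzko1973] G.-C. Rota, D. Kahaner, A. Odlyzko, *On the foundations of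
  combinatorial theory VIII. Finite operator calculus*, J. Math. Anal. Appl. 42 (1973) 684–760,
  §11, pp. 730–731 (with §4 Theorem 4, p. 695, and §7 Theorem 7 / Proposition 4, pp. 709–711).
-/

noncomputable section

open Polynomial Finset

namespace Literature.Algebra.Polynomial

variable (K : Type*) [Field K] [CharZero K]

/-! ## The series `a + (1 − a) t` and `f (t) = t/((1 − a) t + a)` -/

section Series

variable {K}
variable (a b : K)

omit [CharZero K] in
/-- `[t⁰] (a + b t) = a`. [cite: RotaKahanerOdlyzko1973, §11, p. 730] -/
theorem constantCoeff_C_add_C_mul_X :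
    PowerSeries.constantCoeff (PowerSeries.C a + PowerSeries.C b * PowerSeries.X : PowerSeries K) = a := by
  rw [map_add, map_mul, PowerSeries.constantCoeff_C, PowerSeries.constantCoeff_C, PowerSeries.constantCoeff_X,
    mul_zero, add_zero]

omit [CharZero K] in
/-- `[tʲ] (a + b t)ⁿ = C(n,j) a^{n−j} bʲ` (the binomial theorem, for "`((1 − a) D + a)ⁿ`").
[cite: RotaKahanerOdlyzko1973, §11, pp. 730–731] -/
theorem coeff_C_add_C_mul_X_pow (n j : ℕ) :
    PowerSeries.coeff j ((PowerSeries.C a + PowerSeries.C b * PowerSeries.X : PowerSeries K) ^ n) =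
      (n.choose j : K) * a ^ (n - j) * b ^ j := by
  rw [add_comm, add_pow, map_sum]
  have hterm : ∀ m ∈ range (n + 1),
      PowerSeries.coeff j ((PowerSeries.C b * PowerSeries.X) ^ m * PowerSeries.C a ^ (n - m) *
        (n.choose m : PowerSeries K)) = if j = m then (n.choose j : K) * a ^ (n - j) * b ^ j else 0 := by
    intro m _
    have hm : (PowerSeries.C b * PowerSeries.X) ^ m * PowerSeries.C a ^ (n - m) * (n.choose m : PowerSeries K) =
        PowerSeries.C ((n.choose m : K) * a ^ (n - m) * b ^ m) * PowerSeries.X ^ m := by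
      rw [map_mul, map_mul, map_natCast, map_pow, map_pow]
      ring
    rw [hm, PowerSeries.coeff_C_mul_X_pow]
    by_cases h : j = m
    · subst h; simp
    · rw [if_neg h, if_neg h]
  rw [sum_congr rfl hterm, sum_ite_eq]
  by_cases hj : j ∈ range (n + 1)
  · rw [if_pos hj]
  · rw [if_neg hj, Nat.choose_eq_zero_of_lt (by simpa using hj), Nat.cast_zero, zero_mul, zero_mul]

omit [CharZero K] in
/-- `a + b t` is invertible for `a ≠ 0`. [cite: RotaKahanerOdlyzko1973, §11, p. 730] -/
theorem constantCoeff_C_add_C_mul_X_ne_zero (ha : a ≠ 0) :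
    PowerSeries.constantCoeff (PowerSeries.C a + PowerSeries.C b * PowerSeries.X : PowerSeries K) ≠ 0 := by
  rwa [constantCoeff_C_add_C_mul_X]

omit [CharZero K] in
/-- … and so is its inverse. [cite: RotaKahanerOdlyzko1973, §11, p. 730] -/
theorem constantCoeff_C_add_C_mul_X_inv_ne_zero (ha : a ≠ 0) :
    PowerSeries.constantCoeff (PowerSeries.C a + PowerSeries.C b * PowerSeries.X : PowerSeries K)⁻¹ ≠ 0 := by
  rw [PowerSeries.constantCoeff_inv, constantCoeff_C_add_C_mul_X]
  exact inv_ne_zero ha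

omit [CharZero K] in
/-- `((a + b t)⁻¹)⁻¹ = a + b t`. [cite: RotaKahanerOdlyzko1973, §11, p. 730] -/
theorem C_add_C_mul_X_inv_inv (ha : a ≠ 0) :
    ((PowerSeries.C a + PowerSeries.C b * PowerSeries.X : PowerSeries K)⁻¹)⁻¹ =
      PowerSeries.C a + PowerSeries.C b * PowerSeries.X := by
  rw [PowerSeries.inv_eq_iff_mul_eq_one (constantCoeff_C_add_C_mul_X_inv_ne_zero a b ha),
    PowerSeries.mul_inv_cancel _ (constantCoeff_C_add_C_mul_X_ne_zero a b ha)]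

omit [CharZero K] in
/-- **"`a⁻¹ t/(a⁻¹ t − 1) = f (t/(t − 1))` with `f (t) = t/[(1 − a) t + a]`"** — the series identity behind
the duplication formula: substituting the Laguerre indicator `K (t) = t/(t − 1)` into
`f (t) = t/((1 − a) t + a)` gives `K (a⁻¹ t)`. [cite: RotaKahanerOdlyzko1973, §11 ("An easy computation
gives `f (t) = t/[(1 − a) t + a]`"), p. 730] -/
theorem X_mul_inv_subst_laguerreSeries (ha : a ≠ 0) :
    ((PowerSeries.X * (PowerSeries.C a + PowerSeries.C (1 - a) * PowerSeries.X : PowerSeries K)⁻¹).subst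
        (PowerSeries.X * (PowerSeries.X - 1 : PowerSeries K)⁻¹) : PowerSeries K) =
      PowerSeries.rescale a⁻¹ (PowerSeries.X * (PowerSeries.X - 1 : PowerSeries K)⁻¹) := by
  set κ : PowerSeries K := PowerSeries.X * (PowerSeries.X - 1 : PowerSeries K)⁻¹ with hκ
  have hκ0 : PowerSeries.constantCoeff κ = 0 := by rw [hκ, map_mul, PowerSeries.constantCoeff_X, zero_mul]
  have hs := PowerSeries.HasSubst.of_constantCoeff_zero' hκ0
  have h1 := PowerSeries.inv_mul_cancel (PowerSeries.X - 1 : PowerSeries K) (constantCoeff_X_sub_one_ne_zero K)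
  have hκX : κ * (PowerSeries.X - 1) = PowerSeries.X := by rw [hκ, mul_assoc, h1, mul_one]
  -- `ψ (K (t)) = a + (1 − a) K (t)` and `ψ (K (t)) · (t − 1) = t − a`
  set w : PowerSeries K := PowerSeries.C a + PowerSeries.C (1 - a) * κ with hw
  have hψκ : ((PowerSeries.C a + PowerSeries.C (1 - a) * PowerSeries.X : PowerSeries K).subst κ : PowerSeries K) = w := by
    rw [PowerSeries.subst_add hs, PowerSeries.subst_mul hs, PowerSeries.subst_C, PowerSeries.subst_C,
      PowerSeries.subst_X hs]
    rfl
  have hw0 : PowerSeries.constantCoeff w ≠ 0 := by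
    rw [hw, map_add, map_mul, PowerSeries.constantCoeff_C, PowerSeries.constantCoeff_C, hκ0, mul_zero, add_zero]
    exact ha
  have hwX : w * (PowerSeries.X - 1) = PowerSeries.X - PowerSeries.C a := by
    have : w * (PowerSeries.X - 1) = PowerSeries.C a * (PowerSeries.X - 1) + PowerSeries.C (1 - a) *
        (κ * (PowerSeries.X - 1)) := by rw [hw]; ring
    rw [this, hκX, map_sub, map_one]
    ring
  have hXa : PowerSeries.constantCoeff (PowerSeries.X - PowerSeries.C a : PowerSeries K) ≠ 0 := by
    rw [map_sub, PowerSeries.constantCoeff_X, PowerSeries.constantCoeff_C, zero_sub]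
    exact neg_ne_zero.2 ha
  -- both sides equal `t/(t − a)`
  have hL : (κ * w⁻¹ : PowerSeries K) = PowerSeries.X * (PowerSeries.X - PowerSeries.C a)⁻¹ := by
    rw [PowerSeries.eq_mul_inv_iff_mul_eq hXa]
    calc κ * w⁻¹ * (PowerSeries.X - PowerSeries.C a) = κ * w⁻¹ * (w * (PowerSeries.X - 1)) := by rw [hwX]
      _ = κ * (PowerSeries.X - 1) * (w⁻¹ * w) := by ring
      _ = PowerSeries.X := by rw [PowerSeries.inv_mul_cancel w hw0, mul_one, hκX]
  have hv0 : PowerSeries.constantCoeff (PowerSeries.C a⁻¹ * PowerSeries.X - 1 : PowerSeries K) ≠ 0 := by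
    rw [map_sub, map_mul, PowerSeries.constantCoeff_X, mul_zero, map_one, zero_sub]
    exact neg_ne_zero.2 one_ne_zero
  have hR : PowerSeries.rescale a⁻¹ κ = PowerSeries.X * (PowerSeries.X - PowerSeries.C a)⁻¹ := by
    rw [hκ, map_mul, rescale_inv (constantCoeff_X_sub_one_ne_zero K), map_sub, PowerSeries.rescale_X, map_one,
      PowerSeries.eq_mul_inv_iff_mul_eq hXa]
    have hXCa : (PowerSeries.X - PowerSeries.C a : PowerSeries K) =
        PowerSeries.C a * (PowerSeries.C a⁻¹ * PowerSeries.X - 1) := by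
      rw [mul_sub, ← mul_assoc, ← map_mul, mul_inv_cancel₀ ha, map_one, one_mul, mul_one]
    calc PowerSeries.C a⁻¹ * PowerSeries.X * (PowerSeries.C a⁻¹ * PowerSeries.X - 1)⁻¹ *
          (PowerSeries.X - PowerSeries.C a)
        = PowerSeries.C a⁻¹ * PowerSeries.X * PowerSeries.C a *
            ((PowerSeries.C a⁻¹ * PowerSeries.X - 1)⁻¹ * (PowerSeries.C a⁻¹ * PowerSeries.X - 1)) := by
          rw [hXCa]; ring
      _ = PowerSeries.X := by
          rw [PowerSeries.inv_mul_cancel _ hv0, mul_one, mul_right_comm, mul_assoc (PowerSeries.C a⁻¹),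
            ← mul_assoc, ← map_mul, inv_mul_cancel₀ ha, map_one, one_mul]
  rw [PowerSeries.subst_mul hs, PowerSeries.subst_X hs,
    powerSeries_inv_subst hκ0 (constantCoeff_C_add_C_mul_X_ne_zero a (1 - a) ha), hψκ, hL, hR]

end Series

/-! ## The basic polynomials of `f (D) = D/((1 − a) D + a)` (Theorem 4) -/

section Basic

variable {K}
variable (a : K)

/-- **"The basic polynomials for `f (D)` are computed by Theorem 4"**: for `f (t) = t/((1 − a) t + a)`,
`a ≠ 0`, the transfer formula `p_n = x ((1 − a) D + a)ⁿ x^{n−1}` gives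
`p_n (x) = Σ_{j=0}^{n} C(n,j) a^{n−j} (1 − a)ʲ (n−1)_j x^{n−j}`.
[cite: RotaKahanerOdlyzko1973, §11, pp. 730–731] [cite: RotaKahanerOdlyzko1973, §4 Theorem 4 (3), p. 695] -/
theorem basicSequence_X_mul_C_add_inv (ha : a ≠ 0) (n : ℕ) :
    (isDeltaOperator_derivative_comp_diffOp (constantCoeff_C_add_C_mul_X_inv_ne_zero a (1 - a) ha)).basicSequence n =
      ∑ j ∈ range (n + 1), ((n.choose j : K) * a ^ (n - j) * (1 - a) ^ j * ((n - 1).descFactorial j : K)) •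
        (X : K[X]) ^ (n - j) := by
  have hψ := constantCoeff_C_add_C_mul_X_inv_ne_zero a (1 - a) ha
  rcases Nat.eq_zero_or_pos n with rfl | hn
  · rw [(isDeltaOperator_derivative_comp_diffOp hψ).isBasicSequence_basicSequence.apply_zero, sum_range_one]
    simp
  rw [(isDeltaOperator_derivative_comp_diffOp hψ).basicSequence_eq_X_mul_diffOp hψ rfl hn.ne',
    C_add_C_mul_X_inv_inv a (1 - a) ha, diffOp_apply_X_pow, mul_sum, Nat.sub_add_cancel hn, sum_range_succ]
  have hlast : ((n.choose n : K) * a ^ (n - n) * (1 - a) ^ n * ((n - 1).descFactorial n : K)) •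
      (X : K[X]) ^ (n - n) = 0 := by
    rw [Nat.descFactorial_eq_zero_iff_lt.2 (Nat.sub_lt hn one_pos), Nat.cast_zero, mul_zero, zero_smul]
  rw [hlast, add_zero]
  refine sum_congr rfl fun j hj => ?_
  have hjn : j < n := mem_range.1 hj
  rw [coeff_C_add_C_mul_X_pow, mul_smul_comm, ← pow_succ', show n - 1 - j + 1 = n - j by omega]

end Basic

/-! ## Erdélyi's duplication formula -/

section Duplication

variable (a : K)

/-- **Erdélyi's formula (the duplication formula for the basic Laguerre polynomials)**, in the indexing
of the transfer formula: for `a ≠ 0`,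
`L_n (a x) = Σ_{j=0}^{n} C(n,j) a^{n−j} (1 − a)ʲ (n − 1)_j · L_{n−j} (x)`
("`L_n (ax)` is basic for `a⁻¹ D/(a⁻¹ D − I)` = `f (K)`, `f (t) = t/[(1 − a) t + a]`, `K = D/(D − I)`; the
basic polynomials `p_n` of `f (D)` come from Theorem 4, and `L_n (ax) = p_n (L (x))` by Theorem 7").
[cite: RotaKahanerOdlyzko1973, §11 ("duplication formulas … Erdélyi's formula"), pp. 730–731] -/
theorem laguerreBasic_comp_C_mul_X (ha : a ≠ 0) (n : ℕ) :
    (laguerreBasic K n).comp (C a * X) =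
      ∑ j ∈ range (n + 1), ((n.choose j : K) * a ^ (n - j) * (1 - a) ^ j * ((n - 1).descFactorial j : K)) •
        laguerreBasic K (n - j) := by
  have hP := isDeltaOperator_diffOp_X_mul_X_sub_one_inv K
  have hp := isBasicSequence_laguerreBasic_diffOp K
  -- `L_n (ax)` is basic for `K (a⁻¹ t)(D)`
  have hLa := hp.comp_C_mul_X ha
  -- the basic set `p_n` of `f (D)`, `f = t ψ⁻¹`, `ψ = a + (1 − a) t`
  have hψ := constantCoeff_C_add_C_mul_X_inv_ne_zero a (1 - a) ha
  have hQ := isDeltaOperator_derivative_comp_diffOp hψ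
  have hq : IsBasicSequence (diffOp (PowerSeries.X *
      (PowerSeries.C a + PowerSeries.C (1 - a) * PowerSeries.X : PowerSeries K)⁻¹)) hQ.basicSequence := by
    rw [← derivative_comp_diffOp_eq]
    exact hQ.isBasicSequence_basicSequence
  -- Theorem 7: `p_n (L (x))` is basic for `f (K (t))(D) = K (a⁻¹ t)(D)`; uniqueness of basic sets
  have hcomp := hp.umbralComp_diffOp_subst hP hq
  rw [X_mul_inv_subst_laguerreSeries a ha] at hcomp
  have hn : (laguerreBasic K n).comp (C a * X) = umbralComp hQ.basicSequence (laguerreBasic K) n :=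
    congrFun (hLa.unique (hP.rescale ha) hcomp) n
  rw [hn, umbralComp_apply, basicSequence_X_mul_C_add_inv a ha n, map_sum]
  exact sum_congr rfl fun j _ => by rw [map_smul, umbral_X_pow]

omit [CharZero K] in
/-- The factorial identity converting the transfer-formula coefficients into Erdélyi's:
`C(n,j) (n−1)_j (n−j)! = n! C(n−1,j)` (`j < n`). [cite: RotaKahanerOdlyzko1973, §11, p. 731] -/
theorem choose_mul_descFactorial_mul_factorial {n j : ℕ} (hj : j < n) :
    n.choose j * (n - 1).descFactorial j * (n - j).factorial = n.factorial * (n - 1).choose j := by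
  have hj' : j ≤ n - 1 := Nat.le_sub_one_of_lt hj
  have h1 := Nat.choose_mul_factorial_mul_factorial hj.le
  have h2 := Nat.choose_mul_factorial_mul_factorial hj'
  have h3 := Nat.factorial_mul_descFactorial hj'
  have hpos : 0 < j.factorial * (n - 1 - j).factorial := Nat.mul_pos (Nat.factorial_pos _) (Nat.factorial_pos _)
  refine Nat.eq_of_mul_eq_mul_right hpos ?_
  calc n.choose j * (n - 1).descFactorial j * (n - j).factorial * (j.factorial * (n - 1 - j).factorial)
      = (n.choose j * j.factorial * (n - j).factorial) * ((n - 1 - j).factorial * (n - 1).descFactorial j) := by ring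
    _ = n.factorial * ((n - 1).choose j * j.factorial * (n - 1 - j).factorial) := by rw [h1, h3, h2]
    _ = n.factorial * (n - 1).choose j * (j.factorial * (n - 1 - j).factorial) := by ring

/-- **Erdélyi's formula as printed**: for `a ≠ 0` and `n ≥ 1`,
`L_n (a x) = Σ_{k=1}^{n} (n!/k!) C(n−1, k−1) aᵏ (1 − a)^{n−k} L_k (x)`.
[cite: RotaKahanerOdlyzko1973, §11 (Erdélyi's formula), p. 731] -/
theorem laguerreBasic_comp_C_mul_X_eq_sum (ha : a ≠ 0) {n : ℕ} (hn : n ≠ 0) :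
    (laguerreBasic K n).comp (C a * X) =
      ∑ k ∈ Icc 1 n, ((n.factorial : K) / (k.factorial : K) * ((n - 1).choose (k - 1) : K) * a ^ k *
        (1 - a) ^ (n - k)) • laguerreBasic K k := by
  have hn' : 0 < n := Nat.pos_of_ne_zero hn
  rw [laguerreBasic_comp_C_mul_X K a ha n, sum_range_succ,
    Nat.descFactorial_eq_zero_iff_lt.2 (Nat.sub_lt hn' one_pos), Nat.cast_zero, mul_zero, zero_smul, add_zero]
  refine sum_nbij' (fun j => n - j) (fun k => n - k) (fun j hj => ?_) (fun k hk => ?_) (fun j hj => ?_)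
    (fun k hk => ?_) (fun j hj => ?_)
  · have := mem_range.1 hj; simp only [mem_Icc]; omega
  · have := mem_Icc.1 hk; simp only [mem_range]; omega
  · have := mem_range.1 hj; omega
  · have := mem_Icc.1 hk; omega
  · have hjn : j < n := mem_range.1 hj
    have hkey : (n.choose j : K) * ((n - 1).descFactorial j : K) =
        (n.factorial : K) / ((n - j).factorial : K) * ((n - 1).choose j : K) := by
      rw [eq_comm, div_mul_eq_mul_div, div_eq_iff (Nat.cast_ne_zero.2 (Nat.factorial_ne_zero _))]
      exact_mod_cast (choose_mul_descFactorial_mul_factorial hjn).symm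
    rw [Nat.sub_sub_self hjn.le, show n - j - 1 = n - 1 - j by omega, Nat.choose_symm (Nat.le_sub_one_of_lt hjn)]
    congr 1
    calc (n.choose j : K) * a ^ (n - j) * (1 - a) ^ j * ((n - 1).descFactorial j : K)
        = (n.choose j : K) * ((n - 1).descFactorial j : K) * a ^ (n - j) * (1 - a) ^ j := by ring
      _ = (n.factorial : K) / ((n - j).factorial : K) * ((n - 1).choose j : K) * a ^ (n - j) * (1 - a) ^ j := by
          rw [hkey]

end Duplication

end Literature.Algebra.Polynomial
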